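import Summits.HodgeConjecture.HodgeConjecture.Theorems.NikulinTwinTransportTwinAnchorGlue
import Summits.HodgeConjecture.HodgeConjecture.Theses.EndoscopicMiddleDegree

/-!
# Route NikulinTwinTransport · item `TwinAnchorGlue` (stmt-HodgeConjecture-14394) from the item
# `CupProductAlgebraic` (stmt-HodgeConjecture-14350)

`Theorems/NikulinTwinTransportTwinAnchorGlue` proves the glue `TwinAnchorGlue :
HodgeIsometryAlgebraic → TwinTwistorTransport → TwinSimilitudeAlgebraic` GRANTED the
multiplicativity `N²H⁴ ∪ N²H⁴ ⊆ N⁴H⁸` of algebraically supported classes on the triple products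
`A ⊗ (B ⊗ C)` of smooth projective surfaces (`twinAnchorGlue_of_cup`; the one input of the
composition of algebraic correspondences between surfaces that the tree does not construct). That
multiplicativity is an instance of an EXISTING statement item of the sub-problem, filed by route
EndoscopicMiddleDegree: `CupProductAlgebraic` (stmt-HodgeConjecture-14350; Voisin II Prop. 9.20 on
the coniveau carrier: `Nˡ H²ˡ ∪ Nᵏ H²ᵏ ⊆ N^{l+k} H^{2(l+k)}` on every smooth projective `X/ℂ`; the
tree reduces it to the moving hypothesis of `cupProduct_mem_algebraicClasses_of_moving`, and
`Theorems/EndoscopicMiddleDegreeCupProductAlgebraicOfChernCharacter` derives it from the named fact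
`Literature.AlgebraicGeometry.HodgeTheory.span_holomorphicBundleChernCharacter_eq_algebraicClasses`,
Voisin I Thm. 11.32 ⊗ ℂ, and the existence of Hodge models). This file records

* `twinAnchorGlue_of_cupProductAlgebraic : CupProductAlgebraic → TwinAnchorGlue`

(the item from the item stmt-HodgeConjecture-14350, instantiated on the sixfolds `A ⊗ (B ⊗ C)`,
`l = k = 2`), so that `TwinAnchorGlue` closes the day `CupProductAlgebraic` does — and, through
`EndoscopicMiddleDegree.cupProductAlgebraic_of_span_chernCharacter`, holds conditionally on the two
named facts just cited.

## References

* [Varesco2023] M. Varesco, Hodge similarities, algebraic classes, and Kuga–Satake varieties,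
  Math. Z. 305 (2023), §2.
* [VoisinHodgeII2003] C. Voisin, Hodge Theory and Complex Algebraic Geometry II, CUP 2003, §9.2.4
  Prop. 9.20.
* [Buskin2019] N. Buskin, Every rational Hodge isometry between two K3 surfaces is algebraic,
  J. reine angew. Math. 755 (2019), Lemma 6.3.
-/

noncomputable section

namespace Summit.HodgeConjecture.HodgeConjecture.Theorems

open CategoryTheory MonoidalCategory
open Literature.AlgebraicGeometry.HodgeTheory Literature.AlgebraicGeometry.Motives
open Literature.AlgebraicTopology.SingularHomology
open Summit.HodgeConjecture.HodgeConjecture.Theses.NikulinTwinTransport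

/-- **`TwinAnchorGlue` from `CupProductAlgebraic`** (item stmt-HodgeConjecture-14350 of route
EndoscopicMiddleDegree: `Nˡ H²ˡ ∪ Nᵏ H²ᵏ ⊆ N^{l+k} H^{2(l+k)}` on every smooth projective `X/ℂ`,
Voisin II Prop. 9.20 on the coniveau carrier). Its instance on the smooth projective sixfolds
`A ⊗ (B ⊗ C)` in degrees `l = k = 2` is the hypothesis `hCUP` of `twinAnchorGlue_of_cup`
(composition of algebraic correspondences between surfaces, Buskin Lemma 6.3, then Varesco's
"similarity = algebraic similarity ∘ isometry"). [cite: VoisinHodgeII2003, §9.2.4 Prop. 9.20]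
[cite: Buskin2019, Lemma 6.3] [cite: Varesco2023, §2] -/
theorem twinAnchorGlue_of_cupProductAlgebraic
    (hCPA : Summit.HodgeConjecture.HodgeConjecture.Theses.EndoscopicMiddleDegree.CupProductAlgebraic) :
    TwinAnchorGlue :=
  twinAnchorGlue_of_cup fun _A _B _C hA hB hC a ha b hb =>
    hCPA (IsSmoothProjective.tensor_holds hA (IsSmoothProjective.tensor_holds hB hC)) 2 2 a b ha hb

end Summit.HodgeConjecture.HodgeConjecture.Theorems

end
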